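/-
Copyright (c) 2026 the pub-hodgecm-mathlib formalisation cell (harness21).  Prover seat hodgecm-mathlib-K2Liu-p09 (g0): Track B «K2-LIT»,
#184♮ = hLiu418 = stmt-HodgeConjecture-24832, file #9 of the K2_Liu road, organ (III-b) step E5′ (B1c: rational Levi and unipotent points); 2026-09-04.
-/
import Summits.HodgeConjecture.HodgeConjecture.Theorems.K2LiuSiegelDoubledLeviMatrix   -- ★ `cstar_levi`, `levi_mul_levi_leviD`, …
import HarnessLib

/-!
# Crux `HLiu418`, Track B road `K2_Liu`, unit U3a «SIEGEL EISENSTEIN SERIES», file #9 — helper 18 (organ (III-b), step E5′, part B1c):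
# RATIONAL POINTS of the Siegel Levi and of the unipotent radical: `m(γ ⊗ 1), n(Y ⊗ 1) ∈ H(L⁺)` for `γ ∈ GL_n(L)`, `Y ∈ M_n(L)` skew

Cell `hodgecm-mathlib`, crux item hLiu418 = `stmt-HodgeConjecture-24832`; squad K2 ∕ K2Liu, prover K2Liu-p09 (g0).  THEOREMS ONLY; lane
`--supports stmt-HodgeConjecture-24832` (count-neutral helper: hypothesis `hφΓ` of ★ `godement_parabolic_integral` for `P_Δ(𝔸)` and the
rationality of the unipotent approximants of PLAN v3 §B2; socket #9 `sig_K2LiuSiegelEisensteinDoubledSummable`).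

`H(L⁺) ≤ H(𝔸)` is ★ `ratH = range toAdelic`, `toAdelic` the entrywise `L → 𝔸_L` on the unitary group `U(c, J^𝔻)(L⁺) ≤ GL_{2n}(L)` of
`J^𝔻 = reindex e₂ e₂ (T ⊕ −T)` (★ `hermD`).  §1: the adapted frame commutes with ring homomorphisms `f` with `f(⅟2) = ⅟2` (`map_cayR`,
`map_cayRinv`, `map_conj_fromBlocks`).  §2: an element of `H(𝔸)` whose matrix is `g ⊗ 1` for a unitary `g ∈ GL_{2n}(L)` is rational
(`mem_ratH_of_coe_eq_map`); the Levi matrix `m(γ)` and the unipotent matrix `n(Y)` over `L` are unitary for `T ⊕ −T` (★ `cstar_levi`,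
★ `cstar_unip_of_skew` over the ring `L`) and map to `m(γ ⊗ 1)`, `n(Y ⊗ 1)`; hence **`mem_ratH_of_blk_eq_levi_map`** and
**`mem_ratH_of_blk_eq_unip_map`**.  [Kudla1994 §2; HarrisKudlaSweet1996 §1 (1.11)–(1.12).]

HONEST LABEL.  Count-neutral helper of the K2_Liu road; it retires nothing by itself: `HC_CM` is proved only modulo the 7 printed
citations (2 remaining named inputs: hLiu418 = `stmt-HodgeConjecture-24832`, h413 = `stmt-HodgeConjecture-24833`) until rung 0 closes.

## References
* [Kudla1994] S. S. Kudla, Israel J. Math. 87 (1994), §2–§3.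
* [HarrisKudlaSweet1996] M. Harris, S. S. Kudla, W. J. Sweet, J. Amer. Math. Soc. 9 (1996), §1 (1.11)–(1.12).
-/

set_option autoImplicit false
-- the mandated namespace repeats the single-problem summit's segment (`HodgeConjecture.HodgeConjecture`)
set_option linter.dupNamespace false

noncomputable section

open scoped Matrix
open NumberField IsDedekindDomain

namespace Summit.HodgeConjecture.HodgeConjecture.Cruxes.HLiu418.K2LiuSiegelDoubledRationalPoints

open Literature.NumberTheory.GelbartRogawski1991.AdaptedBlocks
open Literature.NumberTheory.Automorphic Literature.NumberTheory.Automorphic.UnitaryGroup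
open Literature.NumberTheory.GelbartRogawski1991 Literature.NumberTheory.GelbartRogawski1991.GRConstruction
open UnitaryDualPair
open Summit.HodgeConjecture.HodgeConjecture.Cruxes.HLiu418.K2LiuSiegelDoubledLeviAlgebra
open Summit.HodgeConjecture.HodgeConjecture.Cruxes.HLiu418.K2LiuSiegelDoubledBlkUnitary
open Summit.HodgeConjecture.HodgeConjecture.Cruxes.HLiu418.K2LiuSiegelDoubledLeviMatrix

/-! ## §1 The adapted frame under ring homomorphisms -/

section Map

variable {R S : Type*} [CommRing R] [CommRing S] [Invertible (2 : R)] [Invertible (2 : S)] {ι : Type*} [Fintype ι] [DecidableEq ι]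
  (f : R →+* S)

omit [Invertible (2 : R)] [Invertible (2 : S)] [Fintype ι] in
/-- `cayR` has entries `0, ±1`: it commutes with ring homomorphisms. [cite: HarrisKudlaSweet1996, §1 (1.11)] -/
theorem map_cayR : (cayR R ι).map f = cayR S ι := by
  rw [cayR, cayR, Matrix.fromBlocks_map, Matrix.map_one f (map_zero f) (map_one f), Matrix.map_neg _ (map_neg f),
    Matrix.map_one f (map_zero f) (map_one f)]

omit [Fintype ι] in
/-- `cayRinv = ⅟2 cayR` commutes with `f` when `f(⅟2) = ⅟2`. [cite: HarrisKudlaSweet1996, §1 (1.11)] -/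
theorem map_cayRinv (hf2 : f (⅟(2 : R)) = ⅟(2 : S)) : (cayRinv R ι).map f = cayRinv S ι := by
  rw [cayRinv, cayRinv, ← map_cayR f]
  ext i j
  simp [hf2]

/-- `(R [[A,B],[C,D]] R⁻¹).map f = R [[f A, f B],[f C, f D]] R⁻¹`. [cite: HarrisKudlaSweet1996, §1 (1.11)] -/
theorem map_conj_fromBlocks (hf2 : f (⅟(2 : R)) = ⅟(2 : S)) (A B C D : Matrix ι ι R) :
    (cayR R ι * Matrix.fromBlocks A B C D * cayRinv R ι).map f =
      cayR S ι * Matrix.fromBlocks (A.map f) (B.map f) (C.map f) (D.map f) * cayRinv S ι := by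
  rw [Matrix.map_mul, Matrix.map_mul, map_cayR, map_cayRinv f hf2, Matrix.fromBlocks_map]

omit [Invertible (2 : R)] [Invertible (2 : S)] [Fintype ι] [DecidableEq ι] in
/-- For `σ`-structures intertwined by `f` (`f ∘ σ = τ ∘ f`): `((X.map σ)ᵀ).map f = ((X.map f).map τ)ᵀ`. [folklore] -/
theorem map_cstar {σ : R →+* R} {τ : S →+* S} (hστ : ∀ x, f (σ x) = τ (f x)) (X : Matrix ι ι R) :
    ((X.map σ)ᵀ).map f = ((X.map f).map τ)ᵀ := by
  ext i j; simp [hστ]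

omit [Invertible (2 : R)] [Invertible (2 : S)] in
/-- The inverse of an invertible matrix commutes with `f`: `(T⁻¹).map f = (T.map f)⁻¹`. [folklore] -/
theorem map_nonsing_inv_of_isUnit {T : Matrix ι ι R} (hT : IsUnit T.det) : (T⁻¹).map f = (T.map f)⁻¹ := by
  have h : (T⁻¹).map f * T.map f = 1 := by
    rw [← Matrix.map_mul, Matrix.nonsing_inv_mul T hT, Matrix.map_one f (map_zero f) (map_one f)]
  exact (Matrix.inv_eq_left_inv h).symm

end Map

/-! ## §2 Rational Levi and unipotent points of `H(𝔸)` -/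

section Doubled

variable (L : Type) [Field L] [NumberField L] [IsCMField L]
variable {N M n : ℕ} (e : Fin N × Fin M ≃ Fin n)
  (dV : Fin N → L) (hdV : ∀ i, IsCMField.complexConj L (dV i) = dV i)
  (dW : Fin M → L) (hdW : ∀ i, IsCMField.complexConj L (dW i) = dW i)

omit [IsCMField L] in
/-- `⅟2 ↦ ⅟2` under `L → 𝔸_L`. [folklore] -/
theorem algebraMap_invOf_two : algebraMap L (AdeleRing (𝓞 L) L) (⅟(2 : L)) = ⅟(2 : AdeleRing (𝓞 L) L) := by
  rw [Literature.NumberTheory.Weil1964.invOf_two_eq_algebraMap L, invOf_eq_inv]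

/-- **`J^𝔻 = reindex e₂ e₂ (T_L ⊕ −T_L)`** with `T_L = gramR ⊗_{L⁺} L`. [cite: GelbartRogawski1991, §3.1 Prop. 3.1.1 p. 455 L1–2] -/
theorem hermD_eq_reindex :
    hermD L e dV hdV dW hdW = Matrix.reindex (e₂ (n := n)) (e₂ (n := n))
      (Matrix.fromBlocks ((gramR L e dV hdV dW hdW).map (algebraMap (Fp L) L)) 0 0 (-(gramR L e dV hdV dW hdW).map (algebraMap (Fp L) L))) := by
  rw [hermD, gramD, Matrix.reindex_apply, Matrix.reindex_apply, ← Matrix.submatrix_map, Matrix.fromBlocks_map,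
    Matrix.map_zero _ (map_zero _), Matrix.map_neg _ (map_neg _)]

/-- **An element of `H(𝔸)` with rational matrix is rational**: if `(q : GL_{2n}(𝔸_L)) = g ⊗ 1` for `g ∈ U(c, J^𝔻)(L⁺)` then `q ∈ H(L⁺)`.
[cite: Kudla1994, §2] -/
theorem mem_ratH_of_coe_eq_map {q : HA L e dV hdV dW hdW} {g : GL (Fin (n + n)) L}
    (hg : g ∈ UnitaryGroup.rational (Fp L) L (IsCMField.complexConj L) (n + n) (hermD L e dV hdV dW hdW))
    (h : ((q : GL (Fin (n + n)) (AdeleRing (𝓞 L) L)) : Matrix (Fin (n + n)) (Fin (n + n)) (AdeleRing (𝓞 L) L)) =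
      (g : Matrix (Fin (n + n)) (Fin (n + n)) L).map (algebraMap L (AdeleRing (𝓞 L) L))) :
    q ∈ ratH L e dV hdV dW hdW := by
  refine ⟨⟨g, hg⟩, Subtype.ext (Units.ext ?_)⟩
  rw [h]
  rfl

/-- `T_L = gramR ⊗ L` data: invertible (`dV, dW ≠ 0`), `c`-fixed, symmetric; and `T_L ⊗ 1 = T_𝔸`. [cite: GelbartRogawski1991, §3.1 Prop. 3.1.1 p. 455 L1–2] -/
theorem gramRL_facts (hdV0 : ∀ i, dV i ≠ 0) (hdW0 : ∀ i, dW i ≠ 0) :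
    IsUnit ((gramR L e dV hdV dW hdW).map (algebraMap (Fp L) L)).det ∧
      ((gramR L e dV hdV dW hdW).map (algebraMap (Fp L) L)).map ((IsCMField.complexConj L : L ≃ₐ[Fp L] L) : L →+* L) =
        (gramR L e dV hdV dW hdW).map (algebraMap (Fp L) L) ∧
      ((gramR L e dV hdV dW hdW).map (algebraMap (Fp L) L))ᵀ = (gramR L e dV hdV dW hdW).map (algebraMap (Fp L) L) ∧
      ((gramR L e dV hdV dW hdW).map (algebraMap (Fp L) L)).map (algebraMap L (AdeleRing (𝓞 L) L)) =
        (gramR L e dV hdV dW hdW).map ((algebraMap L (AdeleRing (𝓞 L) L)).comp (algebraMap (Fp L) L)) := by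
  refine ⟨?_, ?_, ?_, ?_⟩
  · have h : (gramR L e dV hdV dW hdW).map (algebraMap (Fp L) L) = (algebraMap (Fp L) L).mapMatrix (gramR L e dV hdV dW hdW) := rfl
    rw [h, ← RingHom.map_det]
    exact (isUnit_det_gramR₀ L e dV hdV hdV0 dW hdW hdW0).map _
  · ext i j
    exact AlgEquiv.commutes (IsCMField.complexConj L) _
  · rw [← Matrix.transpose_map, (gramR_isSymm L e dV hdV dW hdW).eq]
  · rw [Matrix.map_map]; rfl

/-- **Rational Levi points**: if `blk q = m(γ ⊗ 1)` for `γ ∈ GL_n(L)` then `q ∈ H(L⁺)`.  [cite: HarrisKudlaSweet1996, §1 (1.11)] -/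
theorem mem_ratH_of_blk_eq_levi_map (hdV0 : ∀ i, dV i ≠ 0) (hdW0 : ∀ i, dW i ≠ 0) (γ : GL (Fin n) L) {q : HA L e dV hdV dW hdW}
    (hq : blk L e dV hdV dW hdW q =
      cayR (AdeleRing (𝓞 L) L) (Fin n) *
        Matrix.fromBlocks ((Matrix.GeneralLinearGroup.map (algebraMap L (AdeleRing (𝓞 L) L)) γ : GL (Fin n) (AdeleRing (𝓞 L) L)) :
            Matrix (Fin n) (Fin n) (AdeleRing (𝓞 L) L)) 0 0
          (((gramR L e dV hdV dW hdW).map ((algebraMap L (AdeleRing (𝓞 L) L)).comp (algebraMap (Fp L) L)))⁻¹ *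
            ((((Matrix.GeneralLinearGroup.map (algebraMap L (AdeleRing (𝓞 L) L)) γ)⁻¹ : GL (Fin n) (AdeleRing (𝓞 L) L)) :
                Matrix (Fin n) (Fin n) (AdeleRing (𝓞 L) L)).map (conjAdele (Fp L) L (IsCMField.complexConj L)))ᵀ *
            (gramR L e dV hdV dW hdW).map ((algebraMap L (AdeleRing (𝓞 L) L)).comp (algebraMap (Fp L) L))) *
        cayRinv (AdeleRing (𝓞 L) L) (Fin n)) :
    q ∈ ratH L e dV hdV dW hdW := by
  obtain ⟨hT, hTσ, hTt, hTA⟩ := gramRL_facts L e dV hdV dW hdW hdV0 hdW0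
  set f : L →+* AdeleRing (𝓞 L) L := algebraMap L (AdeleRing (𝓞 L) L) with hf
  set c : L →+* L := ((IsCMField.complexConj L : L ≃ₐ[Fp L] L) : L →+* L) with hc
  set TL : Matrix (Fin n) (Fin n) L := (gramR L e dV hdV dW hdW).map (algebraMap (Fp L) L) with hTL
  have hσ : ∀ x, c (c x) = x := fun x => IsCMField.complexConj_apply_apply L x
  have hf2 : f (⅟(2 : L)) = ⅟(2 : AdeleRing (𝓞 L) L) := algebraMap_invOf_two L
  have hfc : ∀ x, f (c x) = conjAdele (Fp L) L (IsCMField.complexConj L) (f x) := fun x => algebraMap_conj (Fp L) L _ x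
  -- the Levi matrices over `L`
  have hγ'γ : ((γ⁻¹ : GL (Fin n) L) : Matrix (Fin n) (Fin n) L) * γ = 1 := by rw [← Units.val_mul, inv_mul_cancel, Units.val_one]
  have hγγ' : (γ : Matrix (Fin n) (Fin n) L) * (γ⁻¹ : GL (Fin n) L) = 1 := by rw [← Units.val_mul, mul_inv_cancel, Units.val_one]
  set mγ : Matrix (Fin n ⊕ Fin n) (Fin n ⊕ Fin n) L :=
    cayR L (Fin n) * Matrix.fromBlocks (γ : Matrix (Fin n) (Fin n) L) 0 0 (TL⁻¹ * (((γ⁻¹ : GL (Fin n) L) : Matrix (Fin n) (Fin n) L).map c)ᵀ * TL) *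
      cayRinv L (Fin n) with hmγ
  set mγ' : Matrix (Fin n ⊕ Fin n) (Fin n ⊕ Fin n) L :=
    cayR L (Fin n) * Matrix.fromBlocks ((γ⁻¹ : GL (Fin n) L) : Matrix (Fin n) (Fin n) L) 0 0 (TL⁻¹ * ((γ : Matrix (Fin n) (Fin n) L).map c)ᵀ * TL) *
      cayRinv L (Fin n) with hmγ'
  have h1 : mγ * mγ' = 1 := by rw [hmγ, hmγ', levi_mul_levi_leviD hT, hγγ', levi_one_leviD hT]
  have h2 : mγ' * mγ = 1 := by rw [hmγ, hmγ', levi_mul_levi_leviD hT, hγ'γ, levi_one_leviD hT]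
  have hcstar : (mγ.map c)ᵀ * Matrix.fromBlocks TL 0 0 (-TL) * mγ = Matrix.fromBlocks TL 0 0 (-TL) := cstar_levi hT hTσ hTt hσ hγ'γ
  -- the reindexed `GL_{2n}(L)` element
  have hr1 : Matrix.reindex (e₂ (n := n)) (e₂ (n := n)) mγ * Matrix.reindex (e₂ (n := n)) (e₂ (n := n)) mγ' = 1 := by
    rw [Matrix.reindex_apply, Matrix.reindex_apply, Matrix.submatrix_mul_equiv, h1, Matrix.submatrix_one_equiv]
  have hr2 : Matrix.reindex (e₂ (n := n)) (e₂ (n := n)) mγ' * Matrix.reindex (e₂ (n := n)) (e₂ (n := n)) mγ = 1 := by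
    rw [Matrix.reindex_apply, Matrix.reindex_apply, Matrix.submatrix_mul_equiv, h2, Matrix.submatrix_one_equiv]
  set g : GL (Fin (n + n)) L := ⟨_, _, hr1, hr2⟩ with hg
  have hgmem : g ∈ UnitaryGroup.rational (Fp L) L (IsCMField.complexConj L) (n + n) (hermD L e dV hdV dW hdW) := by
    change ((Matrix.reindex (e₂ (n := n)) (e₂ (n := n)) mγ).map c)ᵀ * hermD L e dV hdV dW hdW * Matrix.reindex (e₂ (n := n)) (e₂ (n := n)) mγ =
      hermD L e dV hdV dW hdW
    rw [hermD_eq_reindex, ← reindex_cstar, ← reindex_mul_mul, hcstar]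
  refine mem_ratH_of_coe_eq_map L e dV hdV dW hdW hgmem ?_
  -- the matrices agree: `q ⊗ = reindex (m(γ) ⊗ 1)`
  change ((q : GL (Fin (n + n)) (AdeleRing (𝓞 L) L)) : Matrix (Fin (n + n)) (Fin (n + n)) (AdeleRing (𝓞 L) L)) =
    (Matrix.reindex (e₂ (n := n)) (e₂ (n := n)) mγ).map f
  rw [← reindex_reindex_symm ((q : GL (Fin (n + n)) (AdeleRing (𝓞 L) L)) : Matrix (Fin (n + n)) (Fin (n + n)) (AdeleRing (𝓞 L) L)),
    show Matrix.reindex (e₂ (n := n)).symm (e₂ (n := n)).symm ((q : GL (Fin (n + n)) (AdeleRing (𝓞 L) L)) :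
      Matrix (Fin (n + n)) (Fin (n + n)) (AdeleRing (𝓞 L) L)) = blk L e dV hdV dW hdW q from rfl, hq,
    Matrix.reindex_apply, Matrix.reindex_apply, ← Matrix.submatrix_map, hmγ, map_conj_fromBlocks f hf2]
  congr 2
  rw [Matrix.map_zero _ (map_zero f), Matrix.map_mul, Matrix.map_mul, map_nonsing_inv_of_isUnit f hT, hTL, hTA, map_cstar f hfc]
  rfl

/-- **Rational unipotent points**: if `blk q = n(Y ⊗ 1)` for a `T_L`-skew `Y ∈ M_n(L)` then `q ∈ H(L⁺)`.
[cite: HarrisKudlaSweet1996, §1 (1.12)] -/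
theorem mem_ratH_of_blk_eq_unip_map {Y : Matrix (Fin n) (Fin n) L}
    (hY : (Y.map ((IsCMField.complexConj L : L ≃ₐ[Fp L] L) : L →+* L))ᵀ * (gramR L e dV hdV dW hdW).map (algebraMap (Fp L) L) +
      (gramR L e dV hdV dW hdW).map (algebraMap (Fp L) L) * Y = 0)
    {q : HA L e dV hdV dW hdW}
    (hq : blk L e dV hdV dW hdW q =
      cayR (AdeleRing (𝓞 L) L) (Fin n) * Matrix.fromBlocks 1 (Y.map (algebraMap L (AdeleRing (𝓞 L) L))) 0 1 * cayRinv (AdeleRing (𝓞 L) L) (Fin n)) :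
    q ∈ ratH L e dV hdV dW hdW := by
  set f : L →+* AdeleRing (𝓞 L) L := algebraMap L (AdeleRing (𝓞 L) L) with hf
  set c : L →+* L := ((IsCMField.complexConj L : L ≃ₐ[Fp L] L) : L →+* L) with hc
  set TL : Matrix (Fin n) (Fin n) L := (gramR L e dV hdV dW hdW).map (algebraMap (Fp L) L) with hTL
  have hf2 : f (⅟(2 : L)) = ⅟(2 : AdeleRing (𝓞 L) L) := algebraMap_invOf_two L
  set nY : Matrix (Fin n ⊕ Fin n) (Fin n ⊕ Fin n) L := cayR L (Fin n) * Matrix.fromBlocks 1 Y 0 1 * cayRinv L (Fin n) with hnY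
  set nY' : Matrix (Fin n ⊕ Fin n) (Fin n ⊕ Fin n) L := cayR L (Fin n) * Matrix.fromBlocks 1 (-Y) 0 1 * cayRinv L (Fin n) with hnY'
  have h1 : nY * nY' = 1 := by rw [hnY, hnY', unip_mul_unip, add_neg_cancel, Matrix.fromBlocks_one, Matrix.mul_one, cayR_mul_cayRinv]
  have h2 : nY' * nY = 1 := by rw [hnY, hnY', unip_mul_unip, neg_add_cancel, Matrix.fromBlocks_one, Matrix.mul_one, cayR_mul_cayRinv]
  have hcstar : (nY.map c)ᵀ * Matrix.fromBlocks TL 0 0 (-TL) * nY = Matrix.fromBlocks TL 0 0 (-TL) := cstar_unip_of_skew _ _ hY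
  have hr1 : Matrix.reindex (e₂ (n := n)) (e₂ (n := n)) nY * Matrix.reindex (e₂ (n := n)) (e₂ (n := n)) nY' = 1 := by
    rw [Matrix.reindex_apply, Matrix.reindex_apply, Matrix.submatrix_mul_equiv, h1, Matrix.submatrix_one_equiv]
  have hr2 : Matrix.reindex (e₂ (n := n)) (e₂ (n := n)) nY' * Matrix.reindex (e₂ (n := n)) (e₂ (n := n)) nY = 1 := by
    rw [Matrix.reindex_apply, Matrix.reindex_apply, Matrix.submatrix_mul_equiv, h2, Matrix.submatrix_one_equiv]
  set g : GL (Fin (n + n)) L := ⟨_, _, hr1, hr2⟩ with hg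
  have hgmem : g ∈ UnitaryGroup.rational (Fp L) L (IsCMField.complexConj L) (n + n) (hermD L e dV hdV dW hdW) := by
    change ((Matrix.reindex (e₂ (n := n)) (e₂ (n := n)) nY).map c)ᵀ * hermD L e dV hdV dW hdW * Matrix.reindex (e₂ (n := n)) (e₂ (n := n)) nY =
      hermD L e dV hdV dW hdW
    rw [hermD_eq_reindex, ← reindex_cstar, ← reindex_mul_mul, hcstar]
  refine mem_ratH_of_coe_eq_map L e dV hdV dW hdW hgmem ?_
  change ((q : GL (Fin (n + n)) (AdeleRing (𝓞 L) L)) : Matrix (Fin (n + n)) (Fin (n + n)) (AdeleRing (𝓞 L) L)) =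
    (Matrix.reindex (e₂ (n := n)) (e₂ (n := n)) nY).map f
  rw [← reindex_reindex_symm ((q : GL (Fin (n + n)) (AdeleRing (𝓞 L) L)) : Matrix (Fin (n + n)) (Fin (n + n)) (AdeleRing (𝓞 L) L)),
    show Matrix.reindex (e₂ (n := n)).symm (e₂ (n := n)).symm ((q : GL (Fin (n + n)) (AdeleRing (𝓞 L) L)) :
      Matrix (Fin (n + n)) (Fin (n + n)) (AdeleRing (𝓞 L) L)) = blk L e dV hdV dW hdW q from rfl, hq,
    Matrix.reindex_apply, Matrix.reindex_apply, ← Matrix.submatrix_map, hnY, map_conj_fromBlocks f hf2,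
    Matrix.map_one f (map_zero f) (map_one f), Matrix.map_zero _ (map_zero f)]

end Doubled

end Summit.HodgeConjecture.HodgeConjecture.Cruxes.HLiu418.K2LiuSiegelDoubledRationalPoints

end
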